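/-
Copyright (c) 2026 the pub-hodgecm-mathlib formalisation cell (harness21).  Prover seat hodgecm-mathlib-R90-C14-p01 (g0), HCML SLAB R90-TF,
section S3 «§12.7 endoscopic character identities» (base `R90-C12`), deal S3-p16 «(J3) the finite ℤ-expansion of `tr (i_c σ̃ ∘ e′)`» (R90-C12-plan (g0),
RULING S3-R14, R90 bus 2026-09-04T22:44:28Z).  2026-09-04.
-/
import Summits.HodgeConjecture.HodgeConjecture.Theorems.R90S3SplitTransportParabolicIndGL3     -- ★ p862646 (J2, K2E3-p17): the split-place frame (`localSplitEquiv`, `IsLocSmooth`, `parabolicIndGL`, `isAdmissible_parabolicIndGL_holds`)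
import Summits.HodgeConjecture.HodgeConjecture.Theorems.K2E3SmoothTraceCompositionSeries       -- ★ (JH-Σ) `exists_smoothIrrep_isConstituentOf_smoothTrace_eq_sum`
import Summits.HodgeConjecture.HodgeConjecture.Theorems.R90S3FiniteLengthOfIrreducible         -- ★ `IsIrreducible.isFiniteLength_asModule`
import Literature.NumberTheory.Automorphic.SmoothIndTransport                                  -- ★ `isFiniteLength_iff_of_equivariant_equiv`
import Literature.NumberTheory.Automorphic.UnitaryGroupLocalTypeSpherical                      -- ★ `isAdmissible_comp_continuousMulEquiv`
import HarnessLib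

/-!
# R90 · S3 — (J3) THE FINITE `ℤ`-EXPANSION OF `tr (i_c σ̃ ∘ e′)` IN IRREDUCIBLE CHARACTERS OF `G′_v`, modulo the finite length of `i_c σ̃`
# (`Theorems/R90S3FiniteExpansionParabolicIndGL3.lean`; hypothesis `hJ3` of ★ p862576 `R90.S3.print_4131b_vanDijkSplit_of`)

Cell `hodgecm-mathlib`, crux H413 (`stmt-HodgeConjecture-24833`), route of record `HCCMUnconditional`; programme R90-TF, section S3 (base `R90-C12`),
seat R90-C14-p01 (g0); deal S3-p16 (R90-C12-plan (g0) RULING S3-R14 22:44:28Z; census `R90/S3/CENSUS-J3-finiteExpansion.R90-C14-p01-g0.md` 70b3c137edd8be86).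
Helper lane `--supports stmt-HodgeConjecture-24833 --as helper`; THEOREMS ONLY (no definition, no instance, no notation, no `sorry`).

THE PRINT [Rogawski1990, §4.13 L. 4.13.1 (b) p. 64 and §13.1 Thm. 13.1.1 (2) p. 198: at a split place the packet trace is a finite combination of traces of the
constituents of `i_G(σ̃)`; BernsteinZelevinsky1977 §2.3 / Thm. 2.8 (finite length of parabolic induction); Casselman1995 §2.1 (Jordan–Hölder for admissible
representations)].  For `r` an irreducible smooth ADMISSIBLE representation of the `(2,1)` block Levi of `GL₃(L_w)` and `e′ : G′_v ≃ₜ* GL₃(L_w)` the ★ split-place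
isomorphism (`localSplitEquiv`): the representation `π := (i_c r) ∘ e′` of `G′_v` is admissible (★ `isAdmissible_parabolicIndGL_holds` + ★ `isAdmissible_comp_continuousMulEquiv`)
and — GRANTED THE FINITE LENGTH of `i_c r` over `ℂ[GL₃(L_w)]` (the tree's NAMED FACT ★ `Representation.isFiniteLength_parabolicIndGL`, [BZ77 §2.3]; taken here as the
HYPOTHESIS `hFL`, the residual local input J3b of the census) — of finite length over `ℂ[G′_v]` (★ `isFiniteLength_iff_of_equivariant_equiv` along `e′`), hence its character is
a finite `ℤ`-combination of characters of irreducible admissible classes (★ (JH-Σ) `exists_smoothIrrep_isConstituentOf_smoothTrace_eq_sum`), packaged as `c : IrrClass G′_v →₀ ℤ`.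
* **`finiteExpansion_parabolicIndGL3_of_isFiniteLength`** — the `hJ3` bytes of ★ p862576 (:163–:175), over `hFL`.  The junction's J3 slot is paid by
  `finiteExpansion_parabolicIndGL3_of_isFiniteLength L H′ v hH′ hH′d νG hFL` MODULO J3b (`hFL`), which is NOT proved here (★ only for supercuspidal unitary σ:
  `R90.S3.isFiniteLength_parabolicIndGL_twoOne_of_supercuspidal`; conditional road ★ `isFiniteLength_parabolicIndGL_of_jacquetGL`).
HONEST LABEL: CONDITIONAL helper (named-fact hypothesis `hFL` = `isFiniteLength_parabolicIndGL`); E's print socket 6 stays OPEN until J3b is ★.  HC_CM is proved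
only modulo the 7 printed citations (2 remaining named inputs: hLiu418 = stmt-HodgeConjecture-24832, h413 = stmt-HodgeConjecture-24833) until rung 0 closes;
count-neutral.

## References
* [Rogawski1990] J. D. Rogawski, *Automorphic Representations of Unitary Groups in Three Variables* (1990), §4.13 Lemma 4.13.1 (b) p. 64; §13.1 Thm. 13.1.1 (2) p. 198.
* [BernsteinZelevinsky1977] I. N. Bernstein, A. V. Zelevinsky, *Induced representations of reductive 𝔭-adic groups I*, Ann. Sci. ÉNS 10 (1977), §2.3, Thm. 2.8.
* [Casselman1995] W. Casselman, *Introduction to the theory of admissible representations of 𝔭-adic reductive groups* (1995), §2.1.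
-/

-- the mandated namespace repeats the single-problem summit's segment (`HodgeConjecture.HodgeConjecture`)
set_option linter.dupNamespace false
set_option autoImplicit false

noncomputable section

namespace Summit.HodgeConjecture.HodgeConjecture.R90.S3

open MeasureTheory IsDedekindDomain NumberField
open Literature.NumberTheory Literature.NumberTheory.Automorphic Literature.NumberTheory.Automorphic.UnitaryGroup
open Literature.NumberTheory.Rogawski1990 Literature.NumberTheory.GaloisRepresentations
open Summit.HodgeConjecture.HodgeConjecture.Cruxes.H413.K2E3SmoothTraceCompositionSeries (exists_smoothIrrep_isConstituentOf_smoothTrace_eq_sum)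
open scoped Matrix

variable (L : Type) [Field L] [NumberField L] [IsCMField L] (H' : Matrix (Fin 3) (Fin 3) L)
  (v : HeightOneSpectrum (𝓞 ↥(maximalRealSubfield L)))

/-- Finsupp bookkeeping: against any `t : X → ℂ`, the finitely supported function `Σ_i δ_{q i}` integrates to `Σ_i t (q i)`. [folklore] -/
theorem sum_support_sum_single_one_mul {X : Type*} [DecidableEq X] (t : X → ℂ) {n : ℕ} (q : Fin n → X) :
    (∑ x ∈ (∑ i, Finsupp.single (q i) (1 : ℤ)).support, (((∑ i, Finsupp.single (q i) (1 : ℤ)) x : ℤ) : ℂ) * t x) = ∑ i, t (q i) := by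
  have h0 : ∀ x : X, (((0 : ℤ) : ℤ) : ℂ) * t x = 0 := fun x => by simp
  have hadd : ∀ (x : X) (m k : ℤ), ((m + k : ℤ) : ℂ) * t x = (m : ℂ) * t x + (k : ℂ) * t x := fun x m k => by push_cast; ring
  change (∑ i, Finsupp.single (q i) (1 : ℤ)).sum (fun x k => (k : ℂ) * t x) = _
  rw [← Finsupp.sum_finsetSum_index h0 hadd]
  refine Finset.sum_congr rfl fun i _ => ?_
  rw [Finsupp.sum_single_index (h0 _)]
  simp

set_option maxHeartbeats 400000 in
/-- **(J3) modulo finite length — THE FINITE `ℤ`-EXPANSION OF `tr (i_c r ∘ e′)` IN IRREDUCIBLE CHARACTERS OF `G′_v`** (= hypothesis `hJ3` of ★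
`print_4131b_vanDijkSplit_of`, token for token, over the NAMED FACT `hFL : isFiniteLength_parabolicIndGL L_w (lastBlockLabel 3)` at every split `w ∣ v`): for
`r` irreducible smooth admissible on the `(2,1)` block Levi, `π := (i_c r) ∘ e′` is admissible and of finite length over `ℂ[G′_v]`, so `tr π(f dνG) = Σ_{π′} c(π′)·tr π′(f dνG)`
for a finitely supported `c : IrrClass G′_v →₀ ℤ` (the Jordan–Hölder multiplicities of a covering chain). [cite: Rogawski1990, §4.13 Lemma 4.13.1 (b) p. 64; §13.1 Thm. 13.1.1 (2) p. 198]
[cite: BernsteinZelevinsky1977, §2.3, Thm. 2.8] [cite: Casselman1995, §2.1] -/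
theorem finiteExpansion_parabolicIndGL3_of_isFiniteLength
    (hH' : (H'.map (cmConjRingHom L))ᵀ = H') (hH'd : IsUnit H'.det)
    [MeasurableSpace ((UnitaryGroup.cmDatum L 3 H').Local v)] [BorelSpace ((UnitaryGroup.cmDatum L 3 H').Local v)]
    (νG : Measure ((UnitaryGroup.cmDatum L 3 H').Local v)) [νG.IsHaarMeasure]
    (hFL : ∀ (w : UnitaryGroup.PlacesOver L v), IsCMField.complexConj L • w.1 ≠ w.1 →
      Representation.isFiniteLength_parabolicIndGL.{0, 0, 0, 0} (w.1.adicCompletion L) (Zelevinsky1980.lastBlockLabel 3)) :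
    ∀ (w : UnitaryGroup.PlacesOver L v) (hw : IsCMField.complexConj L • w.1 ≠ w.1)
      (r : SmoothIrrep (Π a, GL {i : Fin 3 // Zelevinsky1980.lastBlockLabel 3 i = a} (w.1.adicCompletion L))),
      r.ρ.IsAdmissible →
      ∃ c : IrrClass ((UnitaryGroup.cmDatum L 3 H').Local v) →₀ ℤ,
        ∀ f : (UnitaryGroup.cmDatum L 3 H').Local v → ℂ, IsLocSmooth f →
          Representation.smoothTrace (G := (UnitaryGroup.cmDatum L 3 H').Local v)
            ((Representation.parabolicIndGL (w.1.adicCompletion L) (Zelevinsky1980.lastBlockLabel 3) r.ρ).comp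
              (UnitaryGroup.localSplitEquiv (IsCMField.complexConj L) H' (IsCMField.complexConj_ne_one L)
                ((UnitaryGroup.map_cmConjRingHom_eq_map_complexConj L H') ▸ hH') w hw
                (UnitaryGroup.isUnit_placeForm_of_isUnit_det hH'd w.1)).toMonoidHom) νG f =
            ∑ π ∈ c.support, (c π : ℂ) * π.smoothTrace νG f := by
  intro w hw r hr
  classical
  -- the split-place isomorphism `e′ : G′_v ≃ₜ* GL₃(L_w)` of record
  let e : (UnitaryGroup.cmDatum L 3 H').Local v ≃ₜ* GL (Fin 3) (w.1.adicCompletion L) :=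
    UnitaryGroup.localSplitEquiv (IsCMField.complexConj L) H' (IsCMField.complexConj_ne_one L)
      ((UnitaryGroup.map_cmConjRingHom_eq_map_complexConj L H') ▸ hH') w hw
      (UnitaryGroup.isUnit_placeForm_of_isUnit_det hH'd w.1)
  -- the induced representation `I = i_c r` on `GL₃(L_w)` and its pull-back `π = I ∘ e′` to `G′_v`
  have hIadm : (Representation.parabolicIndGL (w.1.adicCompletion L) (Zelevinsky1980.lastBlockLabel 3) r.ρ).IsAdmissible :=
    Representation.isAdmissible_parabolicIndGL_holds (w.1.adicCompletion L) (Zelevinsky1980.lastBlockLabel 3) r.ρ hr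
  have hπadm : Representation.IsAdmissible
      ((Representation.parabolicIndGL (w.1.adicCompletion L) (Zelevinsky1980.lastBlockLabel 3) r.ρ).comp e.toMonoidHom) :=
    isAdmissible_comp_continuousMulEquiv hIadm e
  -- finite length: `r` irreducible ⇒ finite length over the Levi; NAMED FACT `hFL` ⇒ `I` of finite length over `ℂ[GL₃]`; transport along `e′`
  have hrfl : IsFiniteLength (MonoidAlgebra ℂ (Π a, GL {i : Fin 3 // Zelevinsky1980.lastBlockLabel 3 i = a} (w.1.adicCompletion L))) r.ρ.asModule :=
    IsIrreducible.isFiniteLength_asModule r.isIrreducible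
  have hIfl : IsFiniteLength (MonoidAlgebra ℂ (GL (Fin 3) (w.1.adicCompletion L)))
      (Representation.parabolicIndGL (w.1.adicCompletion L) (Zelevinsky1980.lastBlockLabel 3) r.ρ).asModule :=
    hFL w hw r.ρ hr hrfl
  have hπfl : IsFiniteLength (MonoidAlgebra ℂ ((UnitaryGroup.cmDatum L 3 H').Local v))
      (Representation.asModule ((Representation.parabolicIndGL (w.1.adicCompletion L) (Zelevinsky1980.lastBlockLabel 3) r.ρ).comp e.toMonoidHom)) :=
    (Representation.isFiniteLength_iff_of_equivariant_equiv
      (ρ' := (Representation.parabolicIndGL (w.1.adicCompletion L) (Zelevinsky1980.lastBlockLabel 3) r.ρ).comp e.toMonoidHom)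
      (ρ := Representation.parabolicIndGL (w.1.adicCompletion L) (Zelevinsky1980.lastBlockLabel 3) r.ρ)
      e.toMulEquiv (LinearEquiv.refl ℂ _) (fun _ _ => rfl)).2 hIfl
  -- Jordan–Hölder: `tr π = Σ_i tr ⟦r_i⟧`
  obtain ⟨n, q, -, -, hsum⟩ := exists_smoothIrrep_isConstituentOf_smoothTrace_eq_sum hπadm hπfl
  -- package as a finitely supported `ℤ`-valued function on classes
  refine ⟨∑ i, Finsupp.single (IrrClass.mk (q i)) 1, fun f _hf => ?_⟩
  exact (hsum νG f).trans
    (sum_support_sum_single_one_mul (fun π : IrrClass ((UnitaryGroup.cmDatum L 3 H').Local v) => π.smoothTrace νG f) (fun i => IrrClass.mk (q i))).symm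

end Summit.HodgeConjecture.HodgeConjecture.R90.S3

end
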